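/-
COR-CM (cell pub-hodgecm2, stage 2 of the Hodge ladder) — count-neutral KERNEL COMBINATORICS «the binary tetrahedral group SL(2,3)», part XIII: TRANSPORT from
the model to `(G, c)` (seat prover-pub-hodgecm2-b23-g53-0, binder prover b23, gen 53; claim HOME/INBOX.md l.24246, NAME ASK l.24300).  Bookkeeping
definitions with bodies (`tr`, `gfOf`, `blockEquiv`) + theorems — gen 45ʼs `Census/OcticProductTransport.lean` for the binary tetrahedral dictionary of part
XII and the motions of part IV (one more motion: the sheared translation of `a`); `decide` only on closed identities in `ZMod 2`, no certificate, no named fact, no `sorry`.  `Interfaces.lean`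
(C1), every E term, B01, `Transposition/*`, `PortJoin/*`, `D2Bridge/*` untouched.
HONEST FRAMING: `HC_CM` is NOT proved, here or anywhere in the tree; nothing here is a period, a count of record or a headline.
T5: n/a-class (hypothesis binders = the fields of `BinaryTetrahedral.Datum`); checker: self.
-/
import Summits.HodgeConjecture.CorCM.Census.BinaryTetrahedralDictionary
import Summits.HodgeConjecture.CorCM.Census.BinaryTetrahedralGeneration
import Summits.HodgeConjecture.CorCM.Census.TwistGenerationDescent

/-!
# The binary tetrahedral group, XIII: transport — model faces to abstract faces, model blocks to blocks, generation to generation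

For a binary tetrahedral datum `D : Datum G c`: §1 the transport isomorphism `tr : ℤ[Ty₄ (ℤ/3)] ≃ₗ ℤ[CMF G c]` (`e_Θ ↦ [typeOf Θ]`), §2 pairs to pairs,
§3 the motions to base changes (`c`, `i`, `ij`, `a`), §4 model faces to abstract faces plus two pairs (`tr_faceVec₄`, `gface_mem`), §5 the abstract face
attached to a model face (`gfOf`), §6 **the blocks of `(G, c)` are the blocks of the model** (`blockEquiv`, `card_block_eq`; a base change is a word in
the motions and conversely), §7 a generating family of model faces transports to a generating family of abstract faces of the same size
(`hodgeSpan_le_of_family`).  All [folklore].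

## References
* [Pohlmann1968] H. Pohlmann, Algebraic cycles on abelian varieties of complex multiplication type, Ann. of Math. 88 (1968), Thm 1.
* [Milne1999] J. S. Milne, Lefschetz motives and the Tate conjecture, Compositio Math. 117 (1999), Prop. 2.1, p. 54.
-/

namespace Summit.HodgeConjecture.CorCM.Census.BinaryTetrahedral

open Finset
open Summit.HodgeConjecture.CorCM.Prior.AllgGroup.RfwfAllgGroup
open Summit.HodgeConjecture.CorCM.Census.BlockParity
open Summit.HodgeConjecture.CorCM.Census.Coinvariant
open Summit.HodgeConjecture.CorCM.Census.OddSliceFacesModel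
open Summit.HodgeConjecture.CorCM.Census.QuarticInversion
open Summit.HodgeConjecture.CorCM.Census.OcticProduct (twZ translZ translZHom translZHom_apply translZ_single)

noncomputable section

variable {G : Type*} [Group G] [Fintype G] [DecidableEq G] {c : G} (D : Datum G c)

/-! ## §1 The transport isomorphism -/

/-- **The transport** `e_Θ ↦ [typeOf Θ]`. [folklore] -/
def tr : (Ty₄ (ZMod 3) → ℤ) ≃ₗ[ℤ] (CMF G c →₀ ℤ) :=
  (Finsupp.linearEquivFunOnFinite ℤ ℤ (Ty₄ (ZMod 3))).symm ≪≫ₗ Finsupp.domLCongr (typeEquiv D).symm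

/-- **Unit vectors go to types.** [folklore] -/
private theorem tr_single₄ (Θ : Ty₄ (ZMod 3)) (n : ℤ) : tr D (Pi.single Θ n) = Finsupp.single ((typeEquiv D).symm Θ) n := by
  rw [tr, LinearEquiv.trans_apply, Finsupp.linearEquivFunOnFinite_symm_single, Finsupp.domLCongr_single]

/-- A vector is the sum of its transported unit vectors. [folklore] -/
private theorem tr_eq_sum₄ (v : Ty₄ (ZMod 3) → ℤ) : tr D v = ∑ Θ, Finsupp.single ((typeEquiv D).symm Θ) (v Θ) := by
  conv_lhs => rw [← Finset.univ_sum_single v]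
  rw [map_sum]
  exact Finset.sum_congr rfl fun Θ _ => tr_single₄ D Θ (v Θ)

/-! ## §2 Pairs -/

/-- **Pairs go to pairs.** [folklore] -/
private theorem tr_pairVec₄ (Θ : Ty₄ (ZMod 3)) : tr D (pairVec₄ (ZMod 3) Θ) = pair c (typeOf D Θ) := by
  rw [pairVec₄, map_add, tr_single₄, tr_single₄, typeEquiv_symm_apply, typeEquiv_symm_apply, pair, typeOf_conj₄]

/-- **The divisor lattices agree**: `tr (pairs₄) = ℤ⟨pairSet c⟩`. [folklore] -/
private theorem map_pairs₄ : (pairs₄ (ZMod 3)).map (tr D : (Ty₄ (ZMod 3) → ℤ) →ₗ[ℤ] (CMF G c →₀ ℤ)) = Submodule.span ℤ (pairSet c) := by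
  rw [pairs₄, Submodule.map_span, ← Set.range_comp]
  have h : ((tr D : (Ty₄ (ZMod 3) → ℤ) →ₗ[ℤ] (CMF G c →₀ ℤ)) ∘ pairVec₄ (ZMod 3)) = pair c ∘ typeOf D :=
    funext fun Θ => by rw [Function.comp_apply, Function.comp_apply, LinearEquiv.coe_coe, tr_pairVec₄]
  have hsurj : Function.Surjective (typeOf (c := c) D) := (typeEquiv D).symm.surjective
  rw [h, hsurj.range_comp]
  rfl

include D in
/-- **`ℤ⟨pairSet⟩` is base-change stable** (`c` is central along the datum). [folklore] -/
private theorem span_pairSet_map_rt_le (Q : G) :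
    (Submodule.span ℤ (pairSet c)).map (Finsupp.lmapDomain ℤ ℤ (rt c Q)) ≤ Submodule.span ℤ (pairSet c) := by
  rw [Submodule.map_span, Submodule.span_le]
  rintro _ ⟨z, ⟨Ψ, rfl⟩, rfl⟩
  exact Submodule.subset_span ⟨rt c Q Ψ, by rw [Finsupp.lmapDomain_apply]; exact (mapDomain_rt_pair_eq c D.hcen Q Ψ).symm⟩

/-! ## §3 Motions are base changes -/

/-- The label motion of `cᵉ`: `typeOf (twH₄ (ζ, 0) Θ) = (typeOf Θ)·cᵉ`. [folklore] -/
private theorem typeOf_twH₄_zmod (ζ : ZMod 2) (Θ : Ty₄ (ZMod 3)) : typeOf D (twH₄ (ZMod 3) (ζ, 0) Θ) = rt c (cpow c ζ) (typeOf D Θ) := by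
  have h01 : ∀ z : ZMod 2, z = 0 ∨ z = 1 := by decide
  rcases h01 ζ with rfl | rfl
  · rw [cpow, if_pos rfl, rt_one, show ((0 : ZMod 2), (0 : ZMod 3)) = 0 from rfl, twH₄_zero]
  · rw [cpow, if_neg one_ne_zero, typeOf_twH₄_one]

/-- The base change along `cᵉ` is `twH₄ (ζ, 0)`. [folklore] -/
private theorem ty_rt_cpow (ζ : ZMod 2) (Ψ : CMF G c) : ty D (rt c (cpow c ζ) Ψ) = twH₄ (ZMod 3) (ζ, 0) (ty D Ψ) := by
  have h01 : ∀ z : ZMod 2, z = 0 ∨ z = 1 := by decide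
  rcases h01 ζ with rfl | rfl
  · rw [cpow, if_pos rfl, rt_one, show ((0 : ZMod 2), (0 : ZMod 3)) = 0 from rfl, twH₄_zero]
  · rw [cpow, if_neg one_ne_zero, ty_rt_c]

/-- **`tr (cᵉ · v) = (tr v)·cᵉ`.** [folklore] -/
private theorem tr_translH₄ (ζ : ZMod 2) (v : Ty₄ (ZMod 3) → ℤ) :
    tr D (translH₄ (ZMod 3) (ζ, 0) v) = Finsupp.mapDomain (rt c (cpow c ζ)) (tr D v) := by
  have hv : translH₄ (ZMod 3) (ζ, 0) v = translH₄Hom (ZMod 3) (ζ, 0) (∑ Θ, Pi.single Θ (v Θ)) := by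
    rw [translH₄Hom_apply, Finset.univ_sum_single]
  rw [hv, map_sum, map_sum, tr_eq_sum₄ D v, Finsupp.mapDomain_finsetSum]
  refine Finset.sum_congr rfl fun Θ _ => ?_
  rw [translH₄Hom_apply, translH₄_single, tr_single₄, typeEquiv_symm_apply, typeEquiv_symm_apply, typeOf_twH₄_zmod, Finsupp.mapDomain_single]

/-- **`tr (i · v) = (tr v)·i⁻¹`.** [folklore] -/
private theorem tr_translZ (v : Ty₄ (ZMod 3) → ℤ) : tr D (translZ (ZMod 3) 1 v) = Finsupp.mapDomain (rt c D.i) (tr D v) := by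
  have hv : translZ (ZMod 3) 1 v = translZHom (ZMod 3) 1 (∑ Θ, Pi.single Θ (v Θ)) := by rw [translZHom_apply, Finset.univ_sum_single]
  rw [hv, map_sum, map_sum, tr_eq_sum₄ D v, Finsupp.mapDomain_finsetSum]
  refine Finset.sum_congr rfl fun Θ _ => ?_
  rw [translZHom_apply, translZ_single, tr_single₄, typeEquiv_symm_apply, typeEquiv_symm_apply, typeOf_twZ, Finsupp.mapDomain_single]

/-- **`tr (ij · v) = (tr v)·(ij)⁻¹`.** [folklore] -/
private theorem tr_translT (v : Ty₄ (ZMod 3) → ℤ) : tr D (translT (ZMod 3) v) = Finsupp.mapDomain (rt c (D.i * D.j)) (tr D v) := by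
  have hv : translT (ZMod 3) v = translTHom (ZMod 3) (∑ Θ, Pi.single Θ (v Θ)) := by rw [translTHom_apply, Finset.univ_sum_single]
  rw [hv, map_sum, map_sum, tr_eq_sum₄ D v, Finsupp.mapDomain_finsetSum]
  refine Finset.sum_congr rfl fun Θ _ => ?_
  rw [translTHom_apply, translT_single, tr_single₄, typeEquiv_symm_apply, typeEquiv_symm_apply, typeOf_twT, Finsupp.mapDomain_single]

/-- **`tr (a · v) = (tr v)·a⁻¹`.** [folklore] -/
private theorem tr_translA (v : Ty₄ (ZMod 3) → ℤ) : tr D (translA (ZMod 3) 1 v) = Finsupp.mapDomain (rt c D.a) (tr D v) := by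
  have hv : translA (ZMod 3) 1 v = translAHom (ZMod 3) 1 (∑ Θ, Pi.single Θ (v Θ)) := by rw [translAHom_apply, Finset.univ_sum_single]
  rw [hv, map_sum, map_sum, tr_eq_sum₄ D v, Finsupp.mapDomain_finsetSum]
  refine Finset.sum_congr rfl fun Θ _ => ?_
  rw [translAHom_apply, translA_single, tr_single₄, typeEquiv_symm_apply, typeEquiv_symm_apply, typeOf_twA, Finsupp.mapDomain_single]

/-! ## §4 Faces: the model's faces are abstract faces plus two pairs -/

/-- **`tr (faceVec₄ Θ p q) = gface (typeOf Θ) (word p) (word q) + pair + pair`.** [folklore] -/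
private theorem tr_faceVec₄ (Θ : Ty₄ (ZMod 3)) (p q : Pl (ZMod 3)) :
    tr D (faceVec₄ (ZMod 3) Θ p q) = gface c D.c_mul_c (typeOf D Θ) (word D p.1 (0, p.2)) (word D q.1 (0, q.2)) +
      pair c (typeOf D (flipAt (ZMod 3) p Θ)) + pair c (typeOf D (flipAt (ZMod 3) q Θ)) := by
  rw [faceVec₄, map_add, map_add, map_add, tr_single₄, tr_single₄, tr_single₄, tr_single₄, typeEquiv_symm_apply, typeEquiv_symm_apply,
    typeEquiv_symm_apply, typeEquiv_symm_apply, gface, pair, pair, typeOf_conj₄, typeOf_conj₄,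
    typeOf_flipAt D p (flipAt (ZMod 3) q Θ), typeOf_flipAt D q Θ, typeOf_flipAt D p Θ]
  abel

omit [Fintype G] in
/-- The place of `word k (e, s)` is the place of `word k (0, s)`. [folklore] -/
private theorem orb_word_mk (k : Fin 4) (e : ZMod 2) (s : ZMod 3) : orb c (word D k (e, s)) = orb c (word D k (0, s)) := by
  have h01 : ∀ u : ZMod 2, u = 0 ∨ u = 1 := by decide
  rcases h01 e with rfl | rfl
  · rfl
  · have hw : word D k (1, s) = c * word D k (0, s) := by rw [c_mul_word, zero_add]
    rw [hw, orb, orb, ← mul_assoc, D.c_mul_c, one_mul, Finset.pair_comm]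

/-- Flipping at `word k (e, s)` is flipping at `word k (0, s)`. [folklore] -/
private theorem oflipCM_word_mk (k : Fin 4) (e : ZMod 2) (s : ZMod 3) (X : CMF G c) :
    oflipCM c D.c_mul_c (word D k (e, s)) X = oflipCM c D.c_mul_c (word D k (0, s)) X := by
  apply Subtype.ext
  show oflip c (word D k (e, s)) X.1 = oflip c (word D k (0, s)) X.1
  rw [oflip, oflip, orb_word_mk D]

/-- **Every abstract face is a transported Hodge vector of the model up to two pairs.** [folklore] -/
private theorem gface_mem (Φ : CMF G c) {t t' : G} (ht' : t' ∉ orb c t) :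
    gface c D.c_mul_c Φ t t' ∈ (hodge₄ (ZMod 3)).map (tr D : (Ty₄ (ZMod 3) → ℤ) →ₗ[ℤ] (CMF G c →₀ ℤ)) ⊔ Submodule.span ℤ (pairSet c) := by
  obtain ⟨k, ⟨e, s⟩, rfl⟩ := exists_word D t
  obtain ⟨k', ⟨e', s'⟩, rfl⟩ := exists_word D t'
  have hpq : ((k, s) : Pl (ZMod 3)) ≠ (k', s') := fun h => ht' (by
    rw [word_mem_orb_word_iff]; exact ⟨(Prod.mk.inj h).1.symm, (Prod.mk.inj h).2.symm⟩)
  have hΦ : Φ = typeOf D (ty D Φ) := (typeOf_ty D Φ).symm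
  have hP : ∀ Ψ : CMF G c, pair c Ψ ∈ Submodule.span ℤ (pairSet c) := fun Ψ => Submodule.subset_span (pair_mem_pairSet c Ψ)
  have e1 : gface c D.c_mul_c Φ (word D k (e, s)) (word D k' (e', s')) = gface c D.c_mul_c Φ (word D k (0, s)) (word D k' (0, s')) := by
    simp only [gface, oflipCM_word_mk D]
  have e2 := tr_faceVec₄ D (ty D Φ) (k, s) (k', s')
  rw [← hΦ] at e2
  have e3 : gface c D.c_mul_c Φ (word D k (0, s)) (word D k' (0, s')) = tr D (faceVec₄ (ZMod 3) (ty D Φ) (k, s) (k', s')) -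
      pair c (typeOf D (flipAt (ZMod 3) (k, s) (ty D Φ))) - pair c (typeOf D (flipAt (ZMod 3) (k', s') (ty D Φ))) := by
    rw [e2]; abel
  rw [e1, e3]
  exact Submodule.sub_mem _ (Submodule.sub_mem _ (Submodule.mem_sup_left ⟨_, faceVec₄_mem (ZMod 3) _ hpq, rfl⟩)
    (Submodule.mem_sup_right (hP _))) (Submodule.mem_sup_right (hP _))

/-! ## §5 The abstract face attached to a model face -/

/-- **The abstract face attached to a model face** `faceVec₄ Θ p q` (`p ≠ q`; a choice of presentation; junk `0` otherwise). [folklore] -/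
def gfOf (f : Ty₄ (ZMod 3) → ℤ) : CMF G c →₀ ℤ :=
  if h : ∃ q : Ty₄ (ZMod 3) × Pl (ZMod 3) × Pl (ZMod 3), q.2.1 ≠ q.2.2 ∧ f = faceVec₄ (ZMod 3) q.1 q.2.1 q.2.2 then
    gface c D.c_mul_c (typeOf D h.choose.1) (word D h.choose.2.1.1 (0, h.choose.2.1.2)) (word D h.choose.2.2.1 (0, h.choose.2.2.2))
  else 0

/-- **The attached abstract face is an abstract face at two distinct places and differs from the transported class by two pairs.** [folklore] -/
private theorem gfOf_spec {f : Ty₄ (ZMod 3) → ℤ} (hf : ∃ Θ p q, p ≠ q ∧ f = faceVec₄ (ZMod 3) Θ p q) :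
    gfOf D f ∈ gfaceSet G c D.c_mul_c ∧ tr D f - gfOf D f ∈ Submodule.span ℤ (pairSet c) := by
  have h : ∃ q : Ty₄ (ZMod 3) × Pl (ZMod 3) × Pl (ZMod 3), q.2.1 ≠ q.2.2 ∧ f = faceVec₄ (ZMod 3) q.1 q.2.1 q.2.2 := by
    obtain ⟨Θ, p, q, hpq, rfl⟩ := hf; exact ⟨(Θ, p, q), hpq, rfl⟩
  have hP : ∀ Ψ : CMF G c, pair c Ψ ∈ Submodule.span ℤ (pairSet c) := fun Ψ => Submodule.subset_span (pair_mem_pairSet c Ψ)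
  obtain ⟨hq, hfq⟩ := h.choose_spec
  rw [gfOf, dif_pos h]
  refine ⟨⟨_, _, _, word_not_mem_orb_of_ne D hq, rfl⟩, ?_⟩
  have e := tr_faceVec₄ D h.choose.1 h.choose.2.1 h.choose.2.2
  rw [← hfq] at e
  rw [e, show ∀ x y z : CMF G c →₀ ℤ, x + y + z - x = y + z from fun x y z => by abel]
  exact Submodule.add_mem _ (hP _) (hP _)

/-! ## §6 Blocks -/

/-- A chain of motions from `ty Ψ` is realised by a base change. [folklore] -/
private theorem exists_rt_of_reach (Ψ : CMF G c) {Θ' : Ty₄ (ZMod 3)}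
    (h : Relation.ReflTransGen (fun Θ₁ Θ₂ : Ty₄ (ZMod 3) =>
      (∃ ζ : ZMod 2, Θ₂ = twH₄ (ZMod 3) (ζ, 0) Θ₁) ∨ Θ₂ = twZ (ZMod 3) 1 Θ₁ ∨ Θ₂ = twT (ZMod 3) Θ₁ ∨ Θ₂ = twA (ZMod 3) 1 Θ₁) (ty D Ψ) Θ') :
    ∃ Q : G, ty D (rt c Q Ψ) = Θ' := by
  induction h with
  | refl => exact ⟨1, by rw [rt_one]⟩
  | tail _ hs ih =>
    obtain ⟨Q, hQ⟩ := ih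
    rcases hs with ⟨ζ, rfl⟩ | rfl | rfl | rfl
    · exact ⟨cpow c ζ * Q, by rw [rt_mul, ty_rt_cpow, hQ]⟩
    · exact ⟨D.i * Q, by rw [rt_mul, ty_rt_i, hQ]⟩
    · exact ⟨D.i * D.j * Q, by rw [rt_mul, ty_rt_k, hQ]⟩
    · exact ⟨D.a * Q, by rw [rt_mul, ty_rt_a, hQ]⟩

/-- One motion step as a chain. [folklore] -/
private theorem reach_of_eq {Θ Θ' : Ty₄ (ZMod 3)}
    (h : (∃ ζ : ZMod 2, Θ' = twH₄ (ZMod 3) (ζ, 0) Θ) ∨ Θ' = twZ (ZMod 3) 1 Θ ∨ Θ' = twT (ZMod 3) Θ ∨ Θ' = twA (ZMod 3) 1 Θ) :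
    Relation.ReflTransGen (fun Θ₁ Θ₂ : Ty₄ (ZMod 3) =>
      (∃ ζ : ZMod 2, Θ₂ = twH₄ (ZMod 3) (ζ, 0) Θ₁) ∨ Θ₂ = twZ (ZMod 3) 1 Θ₁ ∨ Θ₂ = twT (ZMod 3) Θ₁ ∨ Θ₂ = twA (ZMod 3) 1 Θ₁) Θ Θ' :=
  Relation.ReflTransGen.single h

/-- Base change by `aⁿ` is a chain of motions. [folklore] -/
private theorem reach_rt_a_pow (X : CMF G c) (n : ℕ) :
    Relation.ReflTransGen (fun Θ₁ Θ₂ : Ty₄ (ZMod 3) =>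
      (∃ ζ : ZMod 2, Θ₂ = twH₄ (ZMod 3) (ζ, 0) Θ₁) ∨ Θ₂ = twZ (ZMod 3) 1 Θ₁ ∨ Θ₂ = twT (ZMod 3) Θ₁ ∨ Θ₂ = twA (ZMod 3) 1 Θ₁)
      (ty D X) (ty D (rt c (D.a ^ n) X)) := by
  induction n with
  | zero => rw [pow_zero, rt_one]
  | succ n ih =>
    rw [pow_succ', rt_mul, ty_rt_a]
    exact ih.tail (Or.inr (Or.inr (Or.inr rfl)))

/-- **Same block in `(G, c)` ↔ same block in the model.** [folklore] -/
private theorem exists_rt_iff_reach (Ψ Ψ' : CMF G c) : (∃ Q : G, rt c Q Ψ = Ψ') ↔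
    Relation.ReflTransGen (fun Θ₁ Θ₂ : Ty₄ (ZMod 3) =>
      (∃ ζ : ZMod 2, Θ₂ = twH₄ (ZMod 3) (ζ, 0) Θ₁) ∨ Θ₂ = twZ (ZMod 3) 1 Θ₁ ∨ Θ₂ = twT (ZMod 3) Θ₁ ∨ Θ₂ = twA (ZMod 3) 1 Θ₁)
      (ty D Ψ) (ty D Ψ') := by
  constructor
  · rintro ⟨Q, rfl⟩
    obtain ⟨k, ⟨e, s⟩, rfl⟩ := exists_word D Q
    -- `rt (cᵉ aˢ x_k) = rt cᵉ ∘ rt aˢ ∘ rt x_k`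
    have hC : ∀ X : CMF G c, Relation.ReflTransGen _ (ty D X) (ty D (rt c (cpow c e) X)) := fun X =>
      reach_of_eq (Or.inl ⟨e, ty_rt_cpow D e X⟩)
    have hI : ∀ X : CMF G c, Relation.ReflTransGen _ (ty D X) (ty D (rt c D.i X)) := fun X => reach_of_eq (Or.inr (Or.inl (ty_rt_i D X)))
    have hK : ∀ X : CMF G c, Relation.ReflTransGen _ (ty D X) (ty D (rt c (D.i * D.j) X)) := fun X =>
      reach_of_eq (Or.inr (Or.inr (Or.inl (ty_rt_k D X))))
    have hX : ∀ X : CMF G c, Relation.ReflTransGen (fun Θ₁ Θ₂ : Ty₄ (ZMod 3) =>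
        (∃ ζ : ZMod 2, Θ₂ = twH₄ (ZMod 3) (ζ, 0) Θ₁) ∨ Θ₂ = twZ (ZMod 3) 1 Θ₁ ∨ Θ₂ = twT (ZMod 3) Θ₁ ∨ Θ₂ = twA (ZMod 3) 1 Θ₁)
        (ty D X) (ty D (rt c (xk D k) X)) := fun X => by
      fin_cases k
      · show Relation.ReflTransGen _ (ty D X) (ty D (rt c 1 X)); rw [rt_one]
      · exact hI X
      · exact hK X
      · show Relation.ReflTransGen _ (ty D X) (ty D (rt c D.j X))
        have hj : D.j = c * D.i * (D.i * D.j) := by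
          rw [mul_assoc c, ← mul_assoc D.i, D.hii, ← mul_assoc, D.c_mul_c, one_mul]
        rw [hj, rt_mul, rt_mul]
        exact ((hK X).trans (hI _)).trans (reach_of_eq (Or.inl ⟨1, ty_rt_c D _⟩))
    show Relation.ReflTransGen _ (ty D Ψ) (ty D (rt c (cpow c e * D.a ^ s.val * xk D k) Ψ))
    rw [rt_mul, rt_mul]
    exact ((hX Ψ).trans (reach_rt_a_pow D _ s.val)).trans (hC _)
  · intro h
    obtain ⟨Q, hQ⟩ := exists_rt_of_reach D Ψ h
    exact ⟨Q, ty_injective D hQ⟩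

/-- **The blocks of `(G, c)` are the blocks of the model**: `BlockParity.Block c ≃ Block`. [folklore] -/
def blockEquiv : BlockParity.Block c ≃ Block :=
  Quotient.congr (typeEquiv D) fun Ψ Ψ' => exists_rt_iff_reach D Ψ Ψ'

include D in
/-- **`#Block = β(G, c)`.** [folklore] -/
theorem card_block_eq : Fintype.card Block = Fintype.card (BlockParity.Block c) := (Fintype.card_congr (blockEquiv D)).symm

/-! ## §7 The transported family -/

include D in
/-- The abstract faces attached to a family of model faces are `G`-faces. [folklore] -/
theorem image_gfOf_subset_gfaceSet {F : Finset (Ty₄ (ZMod 3) → ℤ)} (hF : ∀ f ∈ F, ∃ Θ p q, p ≠ q ∧ f = faceVec₄ (ZMod 3) Θ p q) :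
    (↑(F.image (gfOf D)) : Set (CMF G c →₀ ℤ)) ⊆ gfaceSet G c D.c_mul_c := by
  intro y hy
  obtain ⟨f, hf, rfl⟩ := Finset.mem_image.mp (Finset.mem_coe.mp hy)
  exact (gfOf_spec D (hF f hf)).1

include D in
/-- **Transport of a generating family of model faces.**  If the `SL(2,3)`-translates of a finite family `F` of model faces, together with the pairs,
span `hodge₄`, then the base changes of the attached abstract faces `F.image gfOf` span `hodgeSpan c` together with the pairs. [folklore] -/
theorem hodgeSpan_le_of_family {F : Finset (Ty₄ (ZMod 3) → ℤ)} (hF : ∀ f ∈ F, ∃ Θ p q, p ≠ q ∧ f = faceVec₄ (ZMod 3) Θ p q)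
    (hgen : hodge₄ (ZMod 3) ≤ pairs₄ (ZMod 3) ⊔ orbSpan (ZMod 3) 1 ↑F) :
    hodgeSpan c D.c_mul_c ≤ Submodule.span ℤ (pairSet c) ⊔ Submodule.span ℤ (translates c (F.image (gfOf D))) := by
  set S' := F.image (gfOf D) with hS'
  set T : Submodule ℤ (CMF G c →₀ ℤ) := Submodule.span ℤ (pairSet c) ⊔ Submodule.span ℤ (translates c S') with hT
  have hTstab : ∀ Q : G, ∀ x ∈ T, Finsupp.mapDomain (rt c Q) x ∈ T := by
    intro Q x hx
    obtain ⟨x₁, h₁, x₂, h₂, rfl⟩ := Submodule.mem_sup.mp hx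
    rw [Finsupp.mapDomain_add]
    exact Submodule.add_mem _
      (Submodule.mem_sup_left (span_pairSet_map_rt_le D Q (Submodule.mem_map_of_mem (f := Finsupp.lmapDomain ℤ ℤ (rt c Q)) h₁)))
      (Submodule.mem_sup_right (TwistGeneration.mapDomain_rt_mem_span_translates c Q S' h₂))
  have horb : orbSpan (ZMod 3) 1 ↑F ≤ T.comap (tr D : (Ty₄ (ZMod 3) → ℤ) →ₗ[ℤ] (CMF G c →₀ ℤ)) := by
    refine orbSpan_le (ZMod 3) 1 ?_ ?_ ?_ ?_ ?_
    · intro f hf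
      obtain ⟨hS, hp⟩ := gfOf_spec D (hF f hf)
      have hmem : gfOf D f ∈ S' := Finset.mem_image_of_mem _ hf
      have e : tr D f = gfOf D f + (tr D f - gfOf D f) := by abel
      show (tr D : (Ty₄ (ZMod 3) → ℤ) →ₗ[ℤ] (CMF G c →₀ ℤ)) f ∈ T
      rw [LinearEquiv.coe_coe, e]
      refine Submodule.add_mem _ (Submodule.mem_sup_right (Submodule.subset_span ⟨1, _, hmem, ?_⟩)) (Submodule.mem_sup_left hp)
      rw [show rt c (1 : G) = id from funext (rt_one c), Finsupp.mapDomain_id]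
    · intro ζ v hv
      show (tr D : (Ty₄ (ZMod 3) → ℤ) →ₗ[ℤ] (CMF G c →₀ ℤ)) (translH₄ (ZMod 3) (ζ, 0) v) ∈ T
      rw [LinearEquiv.coe_coe, tr_translH₄]; exact hTstab _ _ hv
    · intro v hv
      show (tr D : (Ty₄ (ZMod 3) → ℤ) →ₗ[ℤ] (CMF G c →₀ ℤ)) (translZ (ZMod 3) 1 v) ∈ T
      rw [LinearEquiv.coe_coe, tr_translZ]; exact hTstab _ _ hv
    · intro v hv
      show (tr D : (Ty₄ (ZMod 3) → ℤ) →ₗ[ℤ] (CMF G c →₀ ℤ)) (translT (ZMod 3) v) ∈ T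
      rw [LinearEquiv.coe_coe, tr_translT]; exact hTstab _ _ hv
    · intro v hv
      show (tr D : (Ty₄ (ZMod 3) → ℤ) →ₗ[ℤ] (CMF G c →₀ ℤ)) (translA (ZMod 3) 1 v) ∈ T
      rw [LinearEquiv.coe_coe, tr_translA]; exact hTstab _ _ hv
  have hmap : (hodge₄ (ZMod 3)).map (tr D : (Ty₄ (ZMod 3) → ℤ) →ₗ[ℤ] (CMF G c →₀ ℤ)) ≤ T := by
    refine (Submodule.map_mono hgen).trans ?_
    rw [Submodule.map_sup, map_pairs₄]
    exact sup_le le_sup_left (Submodule.map_le_iff_le_comap.mpr horb)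
  refine sup_le (Submodule.span_le.mpr ?_) le_sup_left
  rintro y ⟨Φ, t, t', ht', rfl⟩
  exact (sup_le hmap le_sup_left) (gface_mem D Φ ht')

end

end Summit.HodgeConjecture.CorCM.Census.BinaryTetrahedral
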